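import Summits.NavierStokesRegularity.FunctionalMining.Candidates

/-!
# EK ⟸ T_LD: every saturating law yields a universal Lyapunov functional

Search for candidate a priori estimates; no regularity claim.

The K0 dictionary's shape note `shapes.T_LD` records that the saturating-law template
`dF/dt ≤ κ ν^{-γ} (2ℰ) F^{1+1/σ}` (`SaturatingLaw F σ γ κ`, tree `Candidates.lean`) and the
"universal Lyapunov functional" template of family EK, `M_F(κ) = K − (σ/κ) ν^{γ+1} F^{−1/σ}`
antitone along every solution, are two spellings of one estimate (energy balance
`dK/dt = −ν‖∇u‖₂² = −2νℰ`). This file proves the direction used by the matrix (rows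
`EK.*|T_M0` are booked "HOLDS ∃κ (inherited)" from the corresponding `T_LD` row): a saturating
law with `σ, κ > 0` makes `M_F(κ)` antitone on every window on which `F > 0`.

With the tree theorems `VelocityL4.velocityL4_saturatingLaw` (`σ = 1, γ = 5`) and
`VelocityL6.velocityL6_saturatingLaw` (`σ = 3, γ = 3`) this gives the matrix rows
`EK.EV.s=4|T_M0` (`K − κ⁻¹ ν⁶ U₄⁻¹`) and `EK.EV.s=6|T_M0` (`K − 3κ⁻¹ ν⁴ U₆^{−1/3}`) as kernel
statements on positive-moment windows; with Lu–Doering (`σ = 1, γ = 3`) it is the Ayala–Protas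
form `K − κ⁻¹ν⁴/ℰ` of `Lyapunov.lean` (there obtained from the integrated estimate).

## Main statements

* `SaturatingLaw.hasDerivWithinAt_rpow_neg_inv` — the calculus step: along a solution,
  `d/dt F^{−1/σ} ≥ −κ σ⁻¹ ν^{−γ} ‖∇u‖₂²` wherever `F > 0`.
* `SaturatingLaw.antitoneOn_lyapunov` — `t ↦ K(u t) − (σ/κ) ν^{γ+1} F(u t)^{−1/σ}` is antitone on
  `[a, b]` along every zero-mean classical solution with `F(u t) > 0` on `[a, b]`.
-/

noncomputable section

open MeasureTheory Set Filter
open scoped Topology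

namespace Summit.NavierStokesRegularity.FunctionalMining

open Literature.Analysis.FunctionSpaces Literature.Analysis.FluidPDE

variable {d : Type*} [Fintype d] [DecidableEq d]

/-- **Calculus step.** Under a saturating law `dF/dt ≤ κ ν^{-γ} (2ℰ) F^{1+1/σ}` with `σ > 0`, along a
zero-mean classical solution and at a time where `F(u t) > 0`, the function `s ↦ F(u s)^{−1/σ}` has
the one-sided derivative `F' · (−σ⁻¹) · F^{−1/σ−1}` within `[a, b]` (`F'` the derivative of
`s ↦ F(u s)` within `[a, b]`), and this derivative is `≥ −(κ/σ) ν^{−γ} ‖∇u(t)‖₂²`. [folklore] -/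
theorem SaturatingLaw.hasDerivWithinAt_rpow_neg_inv
    {F : (UnitAddTorus d → EuclideanSpace ℝ d) → ℝ} {σ γ κ : ℝ}
    (hF : SaturatingLaw (d := d) F σ γ κ) (hσ : 0 < σ)
    (hd : Fintype.card d = 3) {ν a b : ℝ} (hν : 0 < ν) (hab : a < b)
    {u : ℝ → UnitAddTorus d → EuclideanSpace ℝ d} {p : ℝ → UnitAddTorus d → ℝ}
    (hsol : Torus.IsClassicalNSSolutionOn (Icc a b) ν 0 u p)
    (hmean : ∀ t ∈ Icc a b, Torus.HasZeroMean (u t)) {t : ℝ} (ht : t ∈ Icc a b)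
    (hpos : 0 < F (u t)) :
    HasDerivWithinAt (fun s => F (u s) ^ (-σ⁻¹))
        (derivWithin (fun s => F (u s)) (Icc a b) t * -σ⁻¹ * F (u t) ^ (-σ⁻¹ - 1)) (Icc a b) t ∧
      -(κ / σ * ν ^ (-γ) * Torus.gradNormSq (u t)) ≤
        derivWithin (fun s => F (u s)) (Icc a b) t * -σ⁻¹ * F (u t) ^ (-σ⁻¹ - 1) := by
  obtain ⟨hdiff, hle⟩ := hF hd hν hab hsol hmean t ht
  have hder : HasDerivWithinAt (fun s => F (u s)) (derivWithin (fun s => F (u s)) (Icc a b) t)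
      (Icc a b) t := hdiff.hasDerivWithinAt
  refine ⟨hder.rpow_const (Or.inl hpos.ne'), ?_⟩
  -- `F' ≤ κ ν^{-γ} (2ℰ) F^{1+1/σ}` and `F^{1+1/σ} · F^{−1/σ−1} = 1`
  have hpow : F (u t) ^ (1 + σ⁻¹) * F (u t) ^ (-σ⁻¹ - 1) = 1 := by
    rw [← Real.rpow_add hpos]
    have : (1 + σ⁻¹) + (-σ⁻¹ - 1) = 0 := by ring
    rw [this, Real.rpow_zero]
  have hc : 0 ≤ σ⁻¹ * F (u t) ^ (-σ⁻¹ - 1) :=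
    mul_nonneg (inv_nonneg.2 hσ.le) (Real.rpow_nonneg hpos.le _)
  have h1 : derivWithin (fun s => F (u s)) (Icc a b) t * (σ⁻¹ * F (u t) ^ (-σ⁻¹ - 1)) ≤
      κ * ν ^ (-γ) * (2 * torusEnstrophy (u t)) * F (u t) ^ (1 + σ⁻¹) *
        (σ⁻¹ * F (u t) ^ (-σ⁻¹ - 1)) :=
    mul_le_mul_of_nonneg_right hle hc
  have h2 : κ * ν ^ (-γ) * (2 * torusEnstrophy (u t)) * F (u t) ^ (1 + σ⁻¹) *
        (σ⁻¹ * F (u t) ^ (-σ⁻¹ - 1)) = κ / σ * ν ^ (-γ) * Torus.gradNormSq (u t) := by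
    rw [gradNormSq_eq_two_mul_torusEnstrophy]
    have : κ * ν ^ (-γ) * (2 * torusEnstrophy (u t)) * F (u t) ^ (1 + σ⁻¹) *
        (σ⁻¹ * F (u t) ^ (-σ⁻¹ - 1)) =
        κ * σ⁻¹ * ν ^ (-γ) * (2 * torusEnstrophy (u t)) *
          (F (u t) ^ (1 + σ⁻¹) * F (u t) ^ (-σ⁻¹ - 1)) := by ring
    rw [this, hpow, mul_one, div_eq_mul_inv]
  have h3 : derivWithin (fun s => F (u s)) (Icc a b) t * -σ⁻¹ * F (u t) ^ (-σ⁻¹ - 1) =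
      -(derivWithin (fun s => F (u s)) (Icc a b) t * (σ⁻¹ * F (u t) ^ (-σ⁻¹ - 1))) := by ring
  rw [h3]
  linarith

/-- **EK ⟸ T_LD: a saturating law yields the universal Lyapunov functional `M_F(κ)`.** If
`dF/dt ≤ κ ν^{-γ} (2ℰ) F^{1+1/σ}` along every zero-mean classical solution of unforced Navier–Stokes on
`T³` (`SaturatingLaw F σ γ κ`) with `σ, κ > 0`, then along every such solution on a window `[a, b]`
on which `F(u t) > 0`, the function `t ↦ K(u t) − (σ/κ) ν^{γ+1} F(u t)^{−1/σ}` is antitone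
(`K = ½‖u‖₂²`; energy balance `dK/dt = −ν‖∇u‖₂²`, and `d/dt F^{−1/σ} ≥ −(κ/σ)ν^{−γ}‖∇u‖₂²`). This is
the inheritance `T_LD ⟹ T_M0` by which the K0 matrix books the rows `EK.*|T_M0`; e.g. with
`VelocityL4.velocityL4_saturatingLaw` it gives `K − κ⁻¹ν⁶/U₄` antitone on positive-`U₄` windows.
Search for candidate a priori estimates; no regularity claim. [folklore] -/
theorem SaturatingLaw.antitoneOn_lyapunov
    {F : (UnitAddTorus d → EuclideanSpace ℝ d) → ℝ} {σ γ κ : ℝ}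
    (hF : SaturatingLaw (d := d) F σ γ κ) (hσ : 0 < σ) (hκ : 0 < κ)
    (hd : Fintype.card d = 3) {ν a b : ℝ} (hν : 0 < ν) (hab : a < b)
    {u : ℝ → UnitAddTorus d → EuclideanSpace ℝ d} {p : ℝ → UnitAddTorus d → ℝ}
    (hsol : Torus.IsClassicalNSSolutionOn (Icc a b) ν 0 u p)
    (hmean : ∀ t ∈ Icc a b, Torus.HasZeroMean (u t))
    (hpos : ∀ t ∈ Icc a b, 0 < F (u t)) :
    AntitoneOn (fun t => Torus.kineticEnergy (u t) - σ / κ * ν ^ (γ + 1) * F (u t) ^ (-σ⁻¹))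
      (Icc a b) := by
  -- energy balance: `dK/dt = −ν‖∇u‖₂²`
  have hK : ∀ s ∈ Icc a b, HasDerivWithinAt (fun r => Torus.kineticEnergy (u r))
      (-ν * Torus.gradNormSq (u s)) (Icc a b) s := by
    intro s hs
    have hb := Torus.IsClassicalNSSolutionOn.energy_balance_holds hsol (convex_Icc a b) hs
    simpa using hb
  -- the one-sided derivative of the Lyapunov combination and its sign
  set m' : ℝ → ℝ := fun s => -ν * Torus.gradNormSq (u s) - σ / κ * ν ^ (γ + 1) *
    (derivWithin (fun r => F (u r)) (Icc a b) s * -σ⁻¹ * F (u s) ^ (-σ⁻¹ - 1)) with hm'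
  have hM : ∀ s ∈ Icc a b, HasDerivWithinAt
      (fun t => Torus.kineticEnergy (u t) - σ / κ * ν ^ (γ + 1) * F (u t) ^ (-σ⁻¹)) (m' s)
        (Icc a b) s ∧ m' s ≤ 0 := by
    intro s hs
    obtain ⟨hg, hle⟩ :=
      hF.hasDerivWithinAt_rpow_neg_inv hσ hd hν hab hsol hmean hs (hpos s hs)
    refine ⟨(hK s hs).sub (hg.const_mul _), ?_⟩
    have hc : 0 ≤ σ / κ * ν ^ (γ + 1) := by positivity
    have h1 : σ / κ * ν ^ (γ + 1) * -(κ / σ * ν ^ (-γ) * Torus.gradNormSq (u s)) ≤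
        σ / κ * ν ^ (γ + 1) *
          (derivWithin (fun r => F (u r)) (Icc a b) s * -σ⁻¹ * F (u s) ^ (-σ⁻¹ - 1)) :=
      mul_le_mul_of_nonneg_left hle hc
    have h2 : σ / κ * ν ^ (γ + 1) * -(κ / σ * ν ^ (-γ) * Torus.gradNormSq (u s)) =
        -ν * Torus.gradNormSq (u s) := by
      have hνγ : ν ^ (γ + 1) * ν ^ (-γ) = ν := by
        rw [← Real.rpow_add hν]
        have : γ + 1 + -γ = 1 := by ring
        rw [this, Real.rpow_one]
      have hσκ : σ / κ * (κ / σ) = 1 := by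
        field_simp
      have : σ / κ * ν ^ (γ + 1) * -(κ / σ * ν ^ (-γ) * Torus.gradNormSq (u s)) =
          -(σ / κ * (κ / σ)) * (ν ^ (γ + 1) * ν ^ (-γ)) * Torus.gradNormSq (u s) := by ring
      rw [this, hνγ, hσκ]
      ring
    simp only [hm']
    linarith
  exact antitoneOn_of_hasDerivWithinAt_nonpos (convex_Icc a b)
    (fun s hs => (hM s hs).1.continuousWithinAt)
    (fun s hs => ((hM s (interior_subset hs)).1).mono interior_subset)
    fun s hs => (hM s (interior_subset hs)).2

end Summit.NavierStokesRegularity.FunctionalMining
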